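import Literature.Geometry.Lorentzian.CarterSliverRegimeKernel
import Literature.Geometry.Lorentzian.CarterSliverLogSmallness
import Literature.Geometry.Lorentzian.CarterThresholdCorePoly
import HarnessLib

/-!
# The threshold-sliver cone kernel bound for Carter's equation in Breitenlohner–Freedman stable
# sectors, Λ-polynomial constants (u-language, tortoise variable)
(namespace `Literature.Geometry.Lorentzian.Kerr`.)

The sliver companion of `CarterThresholdCorePoly.thresholdRegime_corePoly`: for the horizon- and
infinity-normalised solutions of Carter's radial equation `u″ + (ω² − V(ρ x))u = 0` (DRSR
arXiv:1402.7034 §5.2.3) at the admissible frequencies of the near-extremal threshold cone with `0 < m`,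
in the THRESHOLD SLIVER `0 < |ω − mω₊| ≤ 2ξ₁κ` and in a BF-stable sector with margin
`(1 + θ₁)(2r₊ω)² ≤ Λ − 2amω`, for `Λ > Λ₀`:

  `‖u_𝓗(x)‖ · ‖u_𝓘(x′)‖ ≤ C · Λ^N · κ^{−N} · ‖u_𝓗 u_𝓘′ − u_𝓘 u_𝓗′‖(x)`,  `x ≤ x′`, `ρ x′ ≥ r₊ + θ(r₊ − r₋)`,

with `ξ₁, Λ₀, a₁, ε₀, C, N` depending only on `(M, θ, θ₁)`, GIVEN the census as a hypothesis:

* `sliverRegime_corePoly`.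

Assembly: `sliverRegime_kernel_le` (explicit constant), the smallness files
(`sliver_fuzz_small`, `sliver_cap_small`, `sliver_log_small` with `ξ₁ = 10⁻¹⁸θ₁′⁴min(θ, 1)`,
`θ₁′ = min(θ₁, 1)`), the two depth conditions from `exists_forall_mul_pow_le_sinh`
(`thresholdDepth_of_large`, `sliverDepth2_of_large`), near extremality from `nearExtremal_of_abs_ge`
(with `2θ`), and the bookkeeping `layerMaster_bounds`, `collarConstant_le_pow`, `sliverFuzz_le_pow`,
`sliverKernelConstant_le_pow` (`N = 124`). Near-extremal Kerr programme, crux `KappaExplicitWaveDecay`.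

## References
* M. Dafermos, I. Rodnianski, Y. Shlapentokh-Rothman, arXiv:1402.7034 = Ann. of Math. 183 (2016),
  §8 (key `DafermosRodnianskiShlapentokhrothman2014`).
* R. Teixeira da Costa, Commun. Math. Phys. 378 (2020), Prop. 2.20 (key `Costa2019`). Folklore assembly.
-/

noncomputable section

open Filter Set Literature.Analysis.ODE
open scoped _root_.Topology _root_.ComplexConjugate

namespace Literature.Geometry.Lorentzian

namespace Kerr

section SliverCorePoly

variable {M a ω Λ : ℝ} {m : ℤ}

set_option maxHeartbeats 400000 in
-- assembly of the explicit-constant theorem with the bookkeeping; large literal constants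
/-- **The sliver-regime cone kernel bound, Λ-polynomial constants (u-language).** GIVEN the census
(first hypothesis), for `M > 0`, `θ > 0`, `θ₁ > 0` there are `ξ₁ > 0`, `Λ₀`, `a₁ < M`, `ε₀ > 0`,
`C > 0`, `N` such that the two-point bound holds in the sliver `0 < |ω − mω₊| ≤ 2ξ₁κ` for admissible
`(ω, m, Λ)` with `0 < m`, `Λ₀ < Λ`, `(1 + θ₁)(2r₊ω)² ≤ Λ − 2amω`, `|ω − mω₊| ≤ ε₀m`, every tortoise
radius, every pair with horizon/infinity data, and all `x ≤ x′` with `ρ x′ ≥ r₊ + θ(r₊ − r₋)`.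
[folklore] -/
theorem sliverRegime_corePoly
    (hcensus : ∀ M : ℝ, 0 < M → ∃ a₁ ε₀ : ℝ, a₁ < M ∧ 0 < ε₀ ∧
      ∀ a : ℝ, a₁ ≤ |a| → IsSubextremal M a →
        ∀ (ω : ℝ) (m : ℤ) (Λ : ℝ), IsAdmissibleTriple a ω m Λ → m ≠ 0 →
          |ω - m * horizonAngularVelocity M a| ≤ ε₀ * |(m : ℝ)| →
            (Ioi (rPlus M a) ∩ {r : ℝ | ω ^ 2 ≤ sepPotential M a ω m Λ r}).OrdConnected)
    {M : ℝ} (hM : 0 < M) {θ : ℝ} (hθ : 0 < θ) {θ₁ : ℝ} (hθ₁ : 0 < θ₁) :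
    ∃ (ξ₁ Λ₀ a₁ ε₀ C : ℝ) (N : ℕ), 0 < ξ₁ ∧ a₁ < M ∧ 0 < ε₀ ∧ 0 < C ∧
      ∀ a : ℝ, a₁ ≤ |a| → IsSubextremal M a →
        ∀ (ω : ℝ) (m : ℤ) (Λ : ℝ), IsAdmissibleTriple a ω m Λ → 0 < m → Λ₀ < Λ →
          (1 + θ₁) * (2 * rPlus M a * ω) ^ 2 ≤ Λ - 2 * a * m * ω →
          |ω - m * horizonAngularVelocity M a| ≤ ε₀ * |(m : ℝ)| →
          ω - m * horizonAngularVelocity M a ≠ 0 →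
          |ω - m * horizonAngularVelocity M a| ≤ 2 * ξ₁ * surfaceGravity M a →
            ∀ ρ : ℝ → ℝ, IsTortoiseRadius M a ρ →
            ∀ uH uH₁ uI uI₁ : ℝ → ℂ,
              (∀ x, HasDerivAt uH (uH₁ x) x ∧
                HasDerivAt uH₁ (-(((ω ^ 2 - sepPotential M a ω m Λ (ρ x) : ℝ) : ℂ) * uH x)) x) →
              (∀ x, HasDerivAt uI (uI₁ x) x ∧
                HasDerivAt uI₁ (-(((ω ^ 2 - sepPotential M a ω m Λ (ρ x) : ℝ) : ℂ) * uI x)) x) →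
              Tendsto (fun x ↦ ‖uH x‖) atBot (𝓝 1) →
              Tendsto (fun x ↦ ‖uH₁ x‖) atBot (𝓝 |ω - m * horizonAngularVelocity M a|) →
              (∀ x, (starRingEnd ℂ (uH x) * uH₁ x).im = -(ω - m * horizonAngularVelocity M a)) →
              Tendsto (fun x ↦ ‖uI x‖) atTop (𝓝 1) →
              Tendsto (fun x ↦ ‖uI₁ x‖) atTop (𝓝 |ω|) →
              (∀ x, (starRingEnd ℂ (uI x) * uI₁ x).im = ω) →
                ∀ x x' : ℝ, x ≤ x' → rPlus M a + θ * (rPlus M a - rMinus M a) ≤ ρ x' →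
                  ‖uH x‖ * ‖uI x'‖ ≤
                    C * Λ ^ N * (surfaceGravity M a)⁻¹ ^ N * ‖uH x * uI₁ x - uI x * uH₁ x‖ := by
  -- the margin may be taken `≤ 1`
  set θ₁' := min θ₁ 1 with hθ₁'def
  have hθ₁' : 0 < θ₁' := lt_min hθ₁ one_pos
  have hθ₁'1 : θ₁' ≤ 1 := min_le_right _ _
  have hθ₁'le : θ₁' ≤ θ₁ := min_le_left _ _
  -- the sliver width
  set ξ₁ : ℝ := 1e-18 * θ₁' ^ 4 * min θ 1 with hξ₁def
  have hmin0 : 0 < min θ 1 := lt_min hθ one_pos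
  have hξ₁0 : 0 < ξ₁ := by rw [hξ₁def]; positivity
  have hξ₁le : ξ₁ ≤ 1e-18 * θ₁' ^ 4 := by
    rw [hξ₁def]; have := min_le_right θ 1
    have h0 : 0 ≤ 1e-18 * θ₁' ^ 4 := by positivity
    nlinarith only [this, h0]
  have hξ₁θ : ξ₁ ≤ 1e-18 * θ₁' ^ 4 * θ := by
    rw [hξ₁def]; exact mul_le_mul_of_nonneg_left (min_le_left _ _) (by positivity)
  have hξ₁half : ξ₁ ≤ 1 / 2 := hξ₁le.trans (by
    have : θ₁' ^ 4 ≤ 1 := pow_le_one₀ hθ₁'.le hθ₁'1; linarith only [this])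
  -- census constants and near-extremality (with `2θ`)
  obtain ⟨a₁, ε₀, ha₁, hε₀, hcen⟩ := hcensus M hM
  obtain ⟨ha₁half, ha₁lt, hnear⟩ := nearExtremal_of_abs_ge hM (by positivity : 0 < 2 * θ) hθ₁' hθ₁'1
  set a₁' := M * (1 - θ₁' ^ 2 / (128 * (1 + 2 * θ) ^ 2)) with ha₁'def
  -- the depth thresholds
  set cB : ℝ := 8 * 678 * (7e4) ^ 16 with hcB
  set cP : ℝ := 676 + 1e4 * cB with hcP
  set cP' : ℝ := 2 + cB with hcP'
  set cL : ℝ := 128 * (16 * cP + cP') with hcL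
  set cE : ℝ := 1 + cP + 829440 * 2451 * (1 + cP') with hcE
  have hcL0 : 0 < cL := by rw [hcL, hcP, hcP', hcB]; positivity
  have hcE0 : 0 < cE := by rw [hcE, hcP, hcP', hcB]; positivity
  have hMi : 0 < M⁻¹ := inv_pos.2 hM
  set AZ : ℝ := 32 * (1 + M + M⁻¹) ^ 4 * (1 + θ₁'⁻¹) with hAZ
  have hAZ0 : 0 < AZ := by rw [hAZ]; positivity
  obtain ⟨Λd, -, hΛd⟩ := exists_forall_mul_pow_le_sinh (C := 864 * cL * AZ ^ 124)
    (show 0 < (θ₁' / 3) ^ 4 / 2048 by positivity) 124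
  obtain ⟨Λd2, -, hΛd2⟩ := exists_forall_mul_pow_le_sinh (C := 288 * cE * AZ ^ 116)
    (show 0 < (θ₁' / 3) ^ 4 / 4096 by positivity) 116
  -- the kernel constant
  set AY : ℝ := 32 * (1 + M + M⁻¹) ^ 4 * (1 + θ⁻¹) * (1 + θ₁'⁻¹) with hAY
  have hAY0 : 0 < AY := by rw [hAY]; positivity
  set cK : ℝ := 6e9 + 4608 * (cP + (829440 * 2451) ^ 2 * cP') with hcK
  have hcK0 : 0 < cK := by rw [hcK, hcP, hcP', hcB]; positivity
  clear_value θ₁' a₁' AZ AY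
  refine ⟨ξ₁, max (max (1.5e14 / θ₁' ^ 3) Λd) Λd2, max a₁ a₁', min ε₀ (1 / (16 * M)), cK * AY ^ 124, 124,
    hξ₁0, max_lt ha₁ ha₁lt, lt_min hε₀ (by positivity), by positivity, ?_⟩
  intro a ha hsub ω m Λ hadm hm hΛ hBF hcone hσ0 hσ ρ hρ uH uH₁ uI uI₁ hu hv hH0 hH1 hHf hI0 hI1 hIf x x' hxx' hx'
  have haM : |a| ≤ M := le_of_lt hsub
  have ha2 : M / 2 ≤ |a| := ha₁half.trans ((le_max_right _ _).trans ha)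
  have hε16 : min ε₀ (1 / (16 * M)) ≤ 1 / (16 * M) := min_le_right _ _
  have hκ : 0 < surfaceGravity M a := hsub.surfaceGravity_pos
  -- census, `ω ≠ 0`, `Λ ≥ 1`
  have hord : (Ioi (rPlus M a) ∩ {r : ℝ | ω ^ 2 ≤ sepPotential M a ω m Λ r}).OrdConnected :=
    hcen a ((le_max_left _ _).trans ha) hsub ω m Λ hadm hm.ne'
      (hcone.trans (mul_le_mul_of_nonneg_right (min_le_left _ _) (abs_nonneg _)))
  obtain ⟨-, -, hω0⟩ := cone_abs_omega_le_div hM haM ha2 hadm hm hε16 hcone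
  have hm1 : (1 : ℝ) ≤ m := by exact_mod_cast hm
  have hΛ1 : 1 ≤ Λ := by nlinarith only [hadm.sq_le, hm1]
  -- the margin with `θ₁'`, near-extremality, `Λ` large
  have hBF' : (1 + θ₁') * (2 * rPlus M a * ω) ^ 2 ≤ Λ - 2 * a * m * ω :=
    le_trans (mul_le_mul_of_nonneg_right (by linarith only [hθ₁'le]) (sq_nonneg _)) hBF
  obtain ⟨hd, hθd2⟩ := hnear a ((le_max_right _ _).trans ha) haM
  have hθd : θ * (rPlus M a - rMinus M a) ≤ θ₁' * M / 8 := by linarith only [hθd2]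
  have hΛ'256 := lambdaPrime_ge_of_margin hM haM ha2 hm hε16 hcone hθ₁'.le hBF'
  have hΛmin : 1.5e14 / θ₁' ^ 3 ≤ Λ := le_trans ((le_max_left _ _).trans (le_max_left _ _)) hΛ.le
  have hsinh := hΛd Λ (le_trans ((le_max_right _ _).trans (le_max_left _ _)) hΛ.le)
  have hsinh2 := hΛd2 Λ (le_trans (le_max_right _ _) hΛ.le)
  rw [hcL, hcP, hcP', hcB, hAZ] at hsinh
  rw [hcE, hcP, hcP', hcB, hAZ] at hsinh2
  -- the sliver abbreviations
  set Es := ((rPlus M a ^ 2 + a ^ 2) * (ω - m * horizonAngularVelocity M a)) ^ 2 / (θ₁' * M / 8) ^ 2 +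
      2 * |(rPlus M a ^ 2 + a ^ 2) * (ω - m * horizonAngularVelocity M a)| * |ω| *
        (1 + (rPlus M a + rMinus M a) / (θ₁' * M / 8)) with hEs
  set f := 1 + 25 * Es / θ₁' with hf
  set Xs := 24 * ((rPlus M a ^ 2 + a ^ 2) * (ω - m * horizonAngularVelocity M a)) ^ 2 /
      ((rPlus M a - rMinus M a) * θ₁' ^ 2 * (Λ - 2 * a * m * ω)) with hXs
  set Xl := ((rPlus M a ^ 2 + a ^ 2) * (ω - m * horizonAngularVelocity M a)) ^ 2 /
      (8 * (rPlus M a - rMinus M a) * (|Λ - 2 * a * m * ω| + 3)) with hXl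
  set Ccap := (3 * rPlus M a * |ω| * (4 * M * rPlus M a * |ω - m * horizonAngularVelocity M a| +
          3 * rPlus M a * |ω| * (rPlus M a - rMinus M a)) +
          21 * (ω - m * horizonAngularVelocity M a) ^ 2 * rPlus M a ^ 3) / (rPlus M a - rMinus M a) +
        |Λ - 2 * a * m * ω| + 3 with hC
  set Acap := Ccap / ((rPlus M a ^ 2 + a ^ 2) * |ω - m * horizonAngularVelocity M a|) with hA
  set εc := 2 * |ω - m * horizonAngularVelocity M a| * Real.exp (Acap * Xs) with hε
  set CA := (2 * rPlus M a) ^ 2 + a ^ 2 with hCA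
  set cQ := θ₁' * (Λ - 2 * a * m * ω) / (32 * CA) with hc
  set r₃ := rPlus M a + 131072 * Xs + 2 * εc / cQ with hr₃
  -- smallness
  obtain ⟨hΛ'big, hEΛ⟩ := sliver_fuzz_small hsub ha2 hadm hm hε16 hcone hθ₁' hθ₁'1 hBF' hξ₁0.le hξ₁le hσ hΛmin hEs
  obtain ⟨h2Xs, hXsd, hK, hn1, hn3, hn4, hn5⟩ := sliver_cap_small hsub ha2 hadm hm hε16 hcone hθ hθ₁' hθ₁'1 hBF'
    hξ₁0.le hξ₁le hξ₁θ hσ0 hσ hXs hXl hC hA hε hCA hc hr₃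
  have hn2 := sliver_log_small hsub ha2 hadm hm hε16 hcone hθ₁' hθ₁'1 hBF' hξ₁le hσ0 hσ hXs hXl hn1 hε hCA hc hr₃
  -- the point `s₃`
  have hd0 : 0 < rPlus M a - rMinus M a := sub_pos.2 hsub.rMinus_lt_rPlus
  have hr₃gt : rPlus M a < r₃ := by
    have h1 : 0 < Xs := by
      have : 2 * Xs ≤ θ * (rPlus M a - rMinus M a) := h2Xs
      rw [hXs]
      have hS : 0 < ((rPlus M a ^ 2 + a ^ 2) * (ω - m * horizonAngularVelocity M a)) ^ 2 := by
        have hAp : 0 < rPlus M a ^ 2 + a ^ 2 := by nlinarith only [rPlus_pos hM a, sq_nonneg a]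
        positivity
      have hΛ'0 : 0 < Λ - 2 * a * m * ω := by linarith only [hΛ'256, hΛ1]
      positivity
    have h2 : 0 ≤ 2 * εc / cQ := by
      have hΛ'0 : 0 < Λ - 2 * a * m * ω := by linarith only [hΛ'256, hΛ1]
      have hCA0 : 0 < CA := by rw [hCA]; nlinarith only [rPlus_pos hM a, sq_nonneg a]
      rw [hε, hc]; positivity
    rw [hr₃]; linarith only [h1, h2]
  obtain ⟨s₃, hs₃⟩ := hρ.exists_apply_eq hr₃gt
  -- the depths
  have hdepth := thresholdDepth_of_large hM haM ha2 hadm hm hε16 hcone hθ₁' hθ₁'1 hΛ'256 hsinh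
    rfl rfl rfl rfl
  have hEsle := sliverFuzz_le (ω := ω) (m := m) hsub hθ₁' hθ₁'1 hξ₁0.le hσ
  have hf0 : 0 ≤ f := by
    have hsum : rPlus M a + rMinus M a = 2 * M := by unfold rPlus rMinus; ring
    have : 0 ≤ Es := by rw [hEs, hsum]; positivity
    rw [hf]; positivity
  have hfle : f ≤ 1 + 25 * (256 * ξ₁ ^ 2 / θ₁' ^ 2 + 68 * ξ₁ * M * |ω| / θ₁') / θ₁' := by
    rw [hf]; gcongr
  have hdepth2 := sliverDepth2_of_large hsub ha2 hadm hm hε16 hcone hθ₁' hθ₁'1 hξ₁0.le hξ₁half hσ hΛ'256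
    hf0 hfle hsinh2 rfl rfl rfl rfl
  -- the explicit-constant bound
  have key := sliverRegime_kernel_le hρ hsub hadm hΛ1 hσ0 hω0 hθ₁' hθ₁'1 hBF' hd hθ hθd hEs hf hΛ'big hEΛ
    hXs hXl h2Xs hXsd hK hord hu hv hH0 hH1 hHf hI0 hI1 hIf hC hA hε hCA hc hr₃ hs₃ hn1 hn2 hn3 hn4 hn5
    rfl rfl rfl rfl rfl rfl rfl hdepth hdepth2 hxx' hx'
  refine key.trans (mul_le_mul_of_nonneg_right ?_ (norm_nonneg _))
  clear key hdepth hdepth2 hsinh hsinh2 hΛd hΛd2 hu hv hH0 hH1 hHf hI0 hI1 hIf hxx' hx' hcen hord hn1 hn2 hn3 hn4 hn5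
    h2Xs hXsd hK hs₃
  -- bookkeeping: every atom is a power of `Y`
  obtain ⟨hY1, hωY, hωiY, hΛY, hκY, hMY, hMiY, hM2Y, hθY, hθ₁Y, hdY⟩ :=
    layerMaster_bounds hsub ha2 hadm hm hε16 hcone hθ hθ₁'
  set Y := 32 * (1 + M + M⁻¹) ^ 4 * (1 + θ⁻¹) * (1 + θ₁'⁻¹) * Λ / surfaceGravity M a with hYdef
  have hYpow : Y ^ 124 = AY ^ 124 * Λ ^ 124 * (surfaceGravity M a)⁻¹ ^ 124 := by
    rw [hYdef, hAY, div_eq_mul_inv, mul_pow, mul_pow]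
  clear_value Y
  have hω0' : 0 < |ω| := abs_pos.2 hω0
  -- `f ≤ 2451 Y⁴`
  obtain ⟨-, hf4⟩ := sliverFuzz_le_pow (ω := ω) hY1 hθ₁' hθ₁Y hM.le hMY hωY hξ₁0.le hξ₁half
  have hfY : f ≤ 2451 * Y ^ 4 := hfle.trans hf4
  clear hfle hf4 hEsle
  -- name the large expressions
  set R := max (7 * M) (max (Real.sqrt (12 * Λ) / |ω|) (1 / (M * ω ^ 2))) with hRdef
  set B := ((ω ^ 2 + 6 * Λ / M ^ 2) / (θ₁' / (100 * M)) ^ 2) ^ 16 *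
      Real.exp (2 * (θ₁' / (100 * M)) * (50 * M ^ 2 / (θ₁' * M / 2))) *
      ((θ₁' / (100 * M)) ^ 2 * (2 + 2 * |ω| * R) ^ 2 + 2 * ω ^ 2) with hBdef
  set PI := Real.sqrt ((2 + 2 * |ω| * R) ^ 2 + B / (θ₁' / (100 * M)) ^ 2) with hPIdef
  set PI' := Real.sqrt (2 * ω ^ 2 + B) with hPI'def
  set Δθ := delta M a (rPlus M a + θ * (rPlus M a - rMinus M a)) with hΔθdef
  set A₀ := 512 * R ^ 2 / (θ₁' * Δθ * ω ^ 2) + 12 * R ^ 2 / θ₁' ^ 2 with hA₀def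
  have hR0 : 0 ≤ R := le_trans (by positivity) (le_max_left _ _)
  have hR : R ≤ 12 * Y ^ 3 := farRadius_le_pow hY1 hΛ1 hΛY hMY hMiY hω0' hωiY
  have hB : B ≤ 8 * 678 * (7e4) ^ 16 * Y ^ 105 :=
    farConstant_B_le_pow hY1 hM hθ₁' hθ₁'1 hωY hΛY (by linarith only [hΛ1]) hM2Y hθ₁Y hMY hR0 hR
  obtain ⟨hPI2, hPI'2⟩ := farEnvelope_sq_le_pow hY1 hM hθ₁' hθ₁'1 hωY hM2Y hθ₁Y hMY hR0 hR hB
  have hB0 : 0 ≤ B := by rw [hBdef]; positivity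
  have hPIsq : PI ^ 2 ≤ (676 + 1e4 * (8 * 678 * (7e4) ^ 16)) * Y ^ 109 := by
    rw [hPIdef, Real.sq_sqrt (by positivity)]; exact hPI2
  have hPI'sq : PI' ^ 2 ≤ (2 + 8 * 678 * (7e4) ^ 16) * Y ^ 105 := by
    rw [hPI'def, Real.sq_sqrt (by positivity)]; exact hPI'2
  -- the collar constant: `A₀ ≤ 6 · (96R²/(θ₁Δθω²) + 12R²/θ₁²) ≤ 6·15552 Y^16`
  have hΔ : θ * (rPlus M a - rMinus M a) ^ 2 ≤ Δθ := by
    rw [hΔθdef, delta_eq_mul haM]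
    have e : (rPlus M a + θ * (rPlus M a - rMinus M a) - rPlus M a) *
        (rPlus M a + θ * (rPlus M a - rMinus M a) - rMinus M a) =
        θ * (rPlus M a - rMinus M a) ^ 2 + θ ^ 2 * (rPlus M a - rMinus M a) ^ 2 := by ring
    rw [e]
    nlinarith only [sq_nonneg θ, sq_nonneg (rPlus M a - rMinus M a)]
  have hΔθ0 : 0 < Δθ := lt_of_lt_of_le (by positivity) hΔ
  have hA₀T := collarConstant_le_pow hY1 hθ hθ₁' hω0' hωiY hθY hθ₁Y hR0 hR hd0 hdY hΔ
  have hA₀ : A₀ ≤ 93312 * Y ^ 16 := by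
    have h1 : 512 * R ^ 2 / (θ₁' * Δθ * ω ^ 2) ≤ 6 * (96 * R ^ 2 / (θ₁' * Δθ * ω ^ 2)) := by
      rw [← mul_div_assoc]; exact div_le_div_of_nonneg_right (by nlinarith only [sq_nonneg R]) (by positivity)
    have h2 : 12 * R ^ 2 / θ₁' ^ 2 ≤ 6 * (12 * R ^ 2 / θ₁' ^ 2) := by
      have : 0 ≤ 12 * R ^ 2 / θ₁' ^ 2 := by positivity
      linarith only [this]
    rw [hA₀def]; linarith only [h1, h2, hA₀T]
  have hA₀0 : 0 ≤ A₀ := by rw [hA₀def]; positivity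
  clear_value R B PI PI' Δθ A₀
  have hKle := sliverKernelConstant_le_pow hY1 hω0' hωiY hM hMiY hθ₁' hθ₁Y hPIsq hPI'sq hA₀0 hA₀ hf0 hfY
  rw [← hcB, ← hcP, ← hcP', ← hcK, hYpow] at hKle
  calc _ ≤ cK * (AY ^ 124 * Λ ^ 124 * (surfaceGravity M a)⁻¹ ^ 124) := hKle
    _ = cK * AY ^ 124 * Λ ^ 124 * (surfaceGravity M a)⁻¹ ^ 124 := by ring

end SliverCorePoly

end Kerr

end Literature.Geometry.Lorentzian

end
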